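import Mathlib

/-!
# `T4Continuum.ShellMeasureLiveEndSharedLetters` — FINDING F-ne7cL05g9-1 IN KERNEL (XREAD X7 of row S92 file 1): a letter∕curl
# norm SHARED across levels against a level-indexed fine scale `η_j → 0` in the (SM) display is forced to be `0`
(cell `pub-balaban`, sub-cell `t4`, spine estimate NE7c (node U5b); NE7c ROUND-2 crew, unit `b2b-balaban-t4-ne7c-formalise-leaf-05`
gen 9; a typing diagnostic on OUR composition `ShellMeasureLiveEndOneCallSlot.hac_live_of_assembled_decay` (row S92 file 1,
p231081), genre `ShellMeasureWilsonSquare.letterwise_hSM_fails` ∕ `ShellMeasurePlaquetteStarClosure`; Mathlib only; [folklore];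
0 `def`, 0 sorry, 0 citation tags)

HONEST FRAMING.  Finite four-torus programme, rung (B)+1 only — NOT infinite volume, NOT a mass gap, NOT the Clay problem.
NE7c NOT PRINTED, NOT PROVED; nothing of Bałaban's is asserted or refuted here.  This file is about the TYPING of one of OUR
hypothesis families: S92 file 1 indexes every binder of the live-level END-II (S80 f3) by run∕comparison∕slot but keeps the
classifier letter norm `κr` and curl norm `κc` as numbers SHARED across all slots (owner Q2), while the (SM) displays read
`hs₁ : ∀ r K s, κc·Z ≤ c₁·(η r (jl r K s))²·zs` and `ha : ∀ r K s, κr·Z ≤ c₂·(η r (jl r K s))·zs` with the fine scale `η` a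
LEVEL profile.  Under the intended scales `η_j = L^{−j}` (N-ne7cp1-g33-1) over the unbounded live levels this forces
`κc = κr = 0` (§1–§2), hence every classifier read-out vanishes (§3) — the END then fires on a trivial classifier only:
TRUE BUT VACUOUS for the intended objects, the family-level form of the owner's F-ne7cp1-g31-1 («letter-wise (SM) is
scale-blind»).  REPAIR (inside the row): index `κr κc` by lattice level like `β η` (`κc r (jl r K s)`), keep `c₁ c₂ zs` shared.
HONEST DEPENDENCY (cell): continuum YM on T⁴ ⇐ BetaPertH ∧ nine spine estimates (0/9 proved); BetaPertH ⇐ (D1) ∧ (D4) ∧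
CAP+tail; G-an2-4 gates asym, D1 and NE2/3/4.
-/

open Filter Topology

namespace Summit.QuantumFields.BalabanUV.T4Continuum.ShellMeasureLiveEndSharedLetters

/-! ## §1 A shared nonnegative constant below a vanishing family is zero -/

/-- **SHARED `κ` AGAINST `η_j² → 0`**: if `0 ≤ κ`, `0 < Z` and `κ·Z ≤ c·η_j²·z` for EVERY level `j` of a scale profile with
`η_j → 0`, then `κ = 0` (the curl-norm display `hs₁` of S92 file 1 with `κc` shared). [folklore] -/
theorem shared_le_sq_scale_forces_zero {κ Z c z : ℝ} {η : ℕ → ℝ} (hκ : 0 ≤ κ) (hZ : 0 < Z)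
    (h : ∀ j, κ * Z ≤ c * η j ^ 2 * z) (hη : Tendsto η atTop (𝓝 0)) : κ = 0 := by
  have hlim : Tendsto (fun j => c * η j ^ 2 * z) atTop (𝓝 (c * 0 ^ 2 * z)) :=
    ((hη.pow 2).const_mul c).mul_const z
  simp only [ne_eq, OfNat.ofNat_ne_zero, not_false_eq_true, zero_pow, mul_zero, zero_mul] at hlim
  have hle : κ * Z ≤ 0 := ge_of_tendsto' hlim fun j => h j
  nlinarith

/-- **SHARED `κ` AGAINST `η_j → 0`** (the letter-norm display `ha` with `κr` shared): `κ·Z ≤ c·η_j·z` for every `j`,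
`η_j → 0`, `0 ≤ κ`, `0 < Z` ⟹ `κ = 0`. [folklore] -/
theorem shared_le_scale_forces_zero {κ Z c z : ℝ} {η : ℕ → ℝ} (hκ : 0 ≤ κ) (hZ : 0 < Z)
    (h : ∀ j, κ * Z ≤ c * η j * z) (hη : Tendsto η atTop (𝓝 0)) : κ = 0 := by
  have hlim : Tendsto (fun j => c * η j * z) atTop (𝓝 (c * 0 * z)) := (hη.const_mul c).mul_const z
  simp only [mul_zero, zero_mul] at hlim
  have hle : κ * Z ≤ 0 := ge_of_tendsto' hlim fun j => h j
  nlinarith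

/-! ## §2 The intended scales `η_j = L^{−j}` vanish along the levels -/

/-- Bałaban's fine scales `η_j = (L⁻¹)^j` with `L > 1` tend to `0` (so §1 applies to every tower whose live levels are
unbounded — END-I quantifies its per-slot (M1) over ALL comparison indices `K`, live levels `≥ K − N₁`). [folklore] -/
theorem eta_tendsto_zero {L : ℝ} (hL : 1 < L) : Tendsto (fun j : ℕ => (L⁻¹) ^ j) atTop (𝓝 0) :=
  tendsto_pow_atTop_nhds_zero_of_lt_one (inv_nonneg.2 (zero_le_one.trans hL.le)) (inv_lt_one_of_one_lt₀ hL)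

/-- **THE (SM) PAIR OF S92 FILE 1 WITH SHARED `κc`, `κr` AND `η_j = L^{−j}` FORCES `κc = κr = 0`** (reading the two displays
along any sequence of slots whose lattice levels exhaust `ℕ` — e.g. the youngest live slot of comparison `K`, level `K`).
`Z` stands for S80 f3's shared field size `(ε₄ + B₀·2dLC₁ε₁) + B₀·4C₂(ε₄ + B₀·2dLC₁ε₁)²`. [folklore] -/
theorem sm_shared_letters_forced_zero {κc κr Z c₁ c₂ zs L : ℝ} (hL : 1 < L) (hκc : 0 ≤ κc) (hκr : 0 ≤ κr) (hZ : 0 < Z)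
    (hs₁ : ∀ j : ℕ, κc * Z ≤ c₁ * ((L⁻¹) ^ j) ^ 2 * zs) (ha : ∀ j : ℕ, κr * Z ≤ c₂ * (L⁻¹) ^ j * zs) :
    κc = 0 ∧ κr = 0 :=
  ⟨shared_le_sq_scale_forces_zero hκc hZ hs₁ (eta_tendsto_zero hL),
    shared_le_scale_forces_zero hκr hZ ha (eta_tendsto_zero hL)⟩

/-! ## §3 Consequence: a read-out bounded by a zero operator norm is the zero read-out -/

/-- A linear read-out with `‖ℓ Y‖ ≤ κ‖Y‖` and `κ = 0` vanishes identically (S92 file 1's `hℓ`∕`hcurl` at `κr = κc = 0`: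
every classifier letter and every curl read-out is `0`, so `holOf` of the letters is the empty-product-like constant and
the classifier — hence, by `hudict`, the tested variable on every section — carries no information). [folklore] -/
theorem readOut_eq_zero_of_norm_le_zero {E F : Type*} [NormedAddCommGroup E] [NormedAddCommGroup F]
    (ℓ : E → F) {κ : ℝ} (hℓ : ∀ Y, ‖ℓ Y‖ ≤ κ * ‖Y‖) (hκ : κ = 0) : ∀ Y, ℓ Y = 0 := fun Y => by
  have h := hℓ Y
  rw [hκ, zero_mul] at h
  exact norm_le_zero_iff.1 h

/-! ## §4 … whereas LEVEL-INDEXED letter norms carry the η² cancellation (the repair is inhabited non-trivially) -/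

/-- With `κc j := c·η_j²` and `κr j := c′·η_j` (B11 (19)∕(25)∕(37) TYPE scalings — locators only) the two displays hold at
EVERY level with the LEVEL-FREE unit-currency inequalities `c·Z ≤ c₁·zs`, `c′·Z ≤ c₂·zs` — nothing forces `c = 0`: the
indexed typing is the one the η² cancellation (WALL §2b (SM) row, `stokes_hSM`) lives in. [folklore] -/
theorem indexed_letters_inhabited {c c' Z c₁ c₂ zs : ℝ} {η : ℕ → ℝ} (hη : ∀ j, 0 ≤ η j) (h₁ : c * Z ≤ c₁ * zs)
    (h₂ : c' * Z ≤ c₂ * zs) :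
    (∀ j, (c * η j ^ 2) * Z ≤ c₁ * η j ^ 2 * zs) ∧ (∀ j, (c' * η j) * Z ≤ c₂ * η j * zs) := by
  refine ⟨fun j => ?_, fun j => ?_⟩
  · have := mul_le_mul_of_nonneg_left h₁ (pow_nonneg (hη j) 2)
    nlinarith
  · have := mul_le_mul_of_nonneg_left h₂ (hη j)
    nlinarith

/-- NON-VACUITY of §4 and SHARPNESS of §1: `c = Z = c₁ = zs = 1`, `η_j = (1∕2)^j` — the indexed displays hold at every
level, while a SHARED `κ` obeying `κ ≤ (1∕2)^{2j}` for all `j` must vanish. [folklore] -/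
example : (∀ j : ℕ, (1 * ((1 / 2 : ℝ) ^ j) ^ 2) * 1 ≤ 1 * ((1 / 2 : ℝ) ^ j) ^ 2 * 1) ∧
    ∀ κ : ℝ, 0 ≤ κ → (∀ j : ℕ, κ * 1 ≤ 1 * (((2 : ℝ)⁻¹) ^ j) ^ 2 * 1) → κ = 0 :=
  ⟨fun _ => le_rfl, fun _ hκ h => shared_le_sq_scale_forces_zero hκ one_pos h (eta_tendsto_zero one_lt_two)⟩


/-! ## §5 The finding at S92 file 1's LITERAL binder shapes -/

/-- **F-ne7cL05g9-1 AT THE LITERAL SHAPES OF `hac_live_of_assembled_decay`.**  With S92 file 1's profiles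
`η : Bool → ℕ → ℝ`, lattice levels `jl : Bool → ℕ → σ → ℕ`, SHARED `κc κr c₁ c₂ zs` and its two (SM) displays `hs₁`, `ha`
VERBATIM (the shared field size abbreviated `Z`, positive as soon as the chart field is non-trivial): if for one run `r` the
lattice levels of the indexed slots EXHAUST `ℕ` (END-I quantifies over every comparison index `K`; the youngest live slot of
comparison `K` sits at level `K`) and that run's scale profile tends to `0` (`η r j = L^{−j}`), then `κc = 0` and `κr = 0`.
[folklore] -/
theorem s92_shared_letters_forced_zero {σ : Type*} {jl : Bool → ℕ → σ → ℕ} {η : Bool → ℕ → ℝ}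
    {κc κr c₁ c₂ zs Z : ℝ} (r : Bool) (hκc : 0 ≤ κc) (hκ : 0 ≤ κr) (hZ : 0 < Z)
    (hs₁ : ∀ r K s, κc * Z ≤ c₁ * η r (jl r K s) ^ 2 * zs) (ha : ∀ r K s, κr * Z ≤ c₂ * η r (jl r K s) * zs)
    (hex : ∀ j, ∃ K s, jl r K s = j) (hη : Tendsto (η r) atTop (𝓝 0)) : κc = 0 ∧ κr = 0 := by
  have h1 : ∀ j, κc * Z ≤ c₁ * η r j ^ 2 * zs := fun j => by
    obtain ⟨K, s, hj⟩ := hex j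
    simpa only [hj] using hs₁ r K s
  have h2 : ∀ j, κr * Z ≤ c₂ * η r j * zs := fun j => by
    obtain ⟨K, s, hj⟩ := hex j
    simpa only [hj] using ha r K s
  exact ⟨shared_le_sq_scale_forces_zero hκc hZ h1 hη, shared_le_scale_forces_zero hκ hZ h2 hη⟩

/-- … and then S92 file 1's `hcurl`∕`hℓ` make EVERY curl read-out and EVERY classifier letter of EVERY slot vanish (shape of
those binders verbatim, one slot). [folklore] -/
theorem s92_readOuts_vanish {𝒴 M : Type*} [NormedAddCommGroup 𝒴] [NormedAddCommGroup M] {ι : Type*} {Pu : Finset ι}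
    (ℓs : ι → List (𝒴 → M)) {κr : ℝ} (hℓ : ∀ p ∈ Pu, ∀ ℓ ∈ ℓs p, ∀ Y, ‖ℓ Y‖ ≤ κr * ‖Y‖) (hκr : κr = 0) :
    ∀ p ∈ Pu, ∀ ℓ ∈ ℓs p, ∀ Y, ℓ Y = 0 :=
  fun p hp ℓ hl => readOut_eq_zero_of_norm_le_zero ℓ (hℓ p hp ℓ hl) hκr

end Summit.QuantumFields.BalabanUV.T4Continuum.ShellMeasureLiveEndSharedLetters
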